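import Summits.QuantumFields.YangMills.Theorems.SwapVirialDeficitZeroModeGroupFourSmallBallBounds
import Summits.QuantumFields.YangMills.Theorems.SwapVirialDeficitZeroModeGroupFourSmallBallTwoScaleJoint
import Summits.QuantumFields.YangMills.Theorems.SwapVirialDeficitZeroModeGroupFourSmallBallTwoScaleProfile
import HarnessLib

/-!
# Exact zero-mode rung, FOUR pairwise nearly commuting letters — XII-a: preliminaries of the LOG-LIMIT assembly
# (zero-mode block of crux ⟨stmt-QuantumFields-24497⟩ `ToronTubeVolumeLaw` in LIMIT form; free-hands support of ⟨stmt-QuantumFields-24197⟩;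
# part XII of fcl-p3 g44's programme, following the recipe of HOME `fcl-p3-g44-memo-24197-K4-two-scale-log.md`)

From part XI's two-sided bounds ✓`Irad_le` / ✓`le_Irad` (any `0 < a ≤ δ ≤ 1`, `r₀ > 0`, constants `B^±` bounding the two-scale volume `V_t` on the
middle region) and the joint continuity ✓`tendsto_volume_twoScale_origin` we assemble:
* §41 `exists_theta` (ε–θ form of the joint limit), `Irad_lt_top`, real forms `Irad_toReal_le` / `le_Irad_toReal`, `middle_small` (on the middle
  region `ρ ∈ (A√t, δ]`, `|a₀| > r₀` the three two-scale parameters are `< θ` once `δ² < θr₀²`, `t ≤ 4A²θ`, `A ≥ max(1, 1/θ)`);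
* §42 (first half) the pure-real bookkeeping `div_lt_of_affine_bound` / `lt_div_of_affine_bound`, the parameter choices `upper_params` /
  `lower_params`, and the middle-regime bounds ★ `Irad_toReal_le_middle` / ★ `le_Irad_toReal_middle`; the limit itself and the headline
  `Haar⁴(N₄(t))/(t⁶·log(1/t)) → π·coneConst⁴·h₀/64` are in part XII-b (`…FourSmallBallLogLimit`).
HONEST LABEL: finite-dimensional measure theory / real analysis on `SU(2)⁴` (plan-level zero-mode rung of DRAFT lines); NOT ⟨24497⟩, NOT ⟨24197⟩;
own crux ⟨22884⟩ OPEN (blocked-on ⟨19935⟩); the Yang–Mills mass gap is NOT proved; no summit is proved by a line.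
Width seat ym-line-sfw-p2-w3 g63 (cell ym-idea-1, free hands), `--supports stmt-QuantumFields-24197`.  THEOREMS ONLY, standard axioms, 0 `sorry`.
References: [cite: GonzalezarroyoAltes1988]; [cite: Vanbaal2001]; [cite: Luscher1983, §2]; [folklore].
-/

set_option autoImplicit false

noncomputable section

open MeasureTheory Quaternion Set Real Filter Topology
open scoped Quaternion ENNReal BigOperators Topology
open Literature.MathematicalPhysics.QuantumLattice
open Summit.QuantumFields.YangMills.Theorems.SwapTwistDeficit.ToronLog

attribute [local instance] Literature.Analysis.FluidPDE.Tao2016.quatMeasurableSpace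
  Literature.Analysis.FluidPDE.Tao2016.quatBorelSpace
  Literature.MathematicalPhysics.QuantumLattice.secondCountableTopology_su2

namespace Summit.QuantumFields.YangMills.Theorems.SwapVirialDeficit.ZeroModeGroup

/-! ## §41 Preliminaries: the joint limit in ε–θ form, finiteness, real forms of the bounds, the middle region -/

/-- ★ ε–θ form of ✓`tendsto_volume_twoScale_origin`: for `ε ≠ 0` there is `θ > 0` with `vol³(T(η,ζ,κ)) ∈ [h₀ − ε, h₀ + ε]` whenever
`0 ≤ η, ζ, κ < θ`. [folklore] -/
theorem exists_theta {ε : ℝ≥0∞} (hε : ε ≠ 0) : ∃ θ : ℝ, 0 < θ ∧ ∀ η ζ κ : ℝ, 0 ≤ η → 0 ≤ ζ → 0 ≤ κ → η < θ → ζ < θ → κ < θ →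
    (((volume : Measure ℍ).prod (volume : Measure ℍ)).prod (volume : Measure ℍ)) (twoScaleSet4 η ζ κ) ∈
      Icc ((((volume : Measure ℍ).prod (volume : Measure ℍ)).prod (volume : Measure ℍ)) (twoScaleSet4 0 0 0) - ε)
        ((((volume : Measure ℍ).prod (volume : Measure ℍ)).prod (volume : Measure ℍ)) (twoScaleSet4 0 0 0) + ε) := by
  have hne : (((volume : Measure ℍ).prod (volume : Measure ℍ)).prod (volume : Measure ℍ)) (twoScaleSet4 0 0 0) ≠ ⊤ :=
    (volume_twoScaleSet4_lt_top le_rfl le_rfl le_rfl).ne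
  have hmem := Filter.Tendsto.eventually_mem tendsto_volume_twoScale_origin (ENNReal.Icc_mem_nhds hne hε)
  obtain ⟨θ, hθ, h⟩ := Metric.mem_nhdsWithin_iff.1 hmem
  refine ⟨θ, hθ, fun η ζ κ hη hζ hκ h1 h2 h3 => ?_⟩
  have hp : ((η, ζ, κ) : ℝ × ℝ × ℝ) ∈ Metric.ball (0 : ℝ × ℝ × ℝ) θ ∩ octant3 := by
    refine ⟨?_, ⟨hη, hζ, hκ⟩⟩
    rw [Metric.mem_ball, Prod.dist_eq, Prod.dist_eq]
    simp only [Prod.fst_zero, Prod.snd_zero, Real.dist_0_eq_abs, abs_of_nonneg hη, abs_of_nonneg hζ, abs_of_nonneg hκ]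
    exact max_lt h1 (max_lt h2 h3)
  exact h hp

/-- `I(t) < ∞` for `t > 0`. [folklore] -/
theorem Irad_lt_top {t : ℝ} (ht : 0 < t) : Irad t < ⊤ := by
  have h := Irad_le (a := 1/2) (δ := 1/2) (r₀ := 1/2) ht (by norm_num) le_rfl (by norm_num) (by norm_num)
    (B := (((volume : Measure ℍ).prod (volume : Measure ℍ)).prod (volume : Measure ℍ)) domSet4)
    (fun r ρ _ hρ _ => Vrad_le_domSet4 t r (lt_trans (by norm_num) hρ.1))
  have hD := volume_domSet4_lt_top.ne
  have hC := decayConst_lt_top.ne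
  refine lt_of_le_of_lt h ?_
  exact ENNReal.add_lt_top.2 ⟨ENNReal.add_lt_top.2 ⟨by finiteness, by finiteness⟩, by finiteness⟩

/-- Real form of ✓`Irad_le` (finite `B⁺`). [folklore] -/
theorem Irad_toReal_le {t a δ r₀ : ℝ} (ht : 0 < t) (ha : 0 < a) (haδ : a ≤ δ) (hδ1 : δ ≤ 1) (hr₀ : 0 < r₀) {B : ℝ≥0∞} (hBt : B ≠ ⊤)
    (hB : ∀ r ρ : ℝ, r₀ < |r| → ρ ∈ Ioc a δ → r ^ 2 + ρ ^ 2 < 1 → Vrad t r ρ ≤ B) :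
    (Irad t).toReal ≤ 2 * (a * (Real.sqrt 2 / (64 * Real.sqrt t))) * decayConst.toReal +
      2 * (1 / (64 * δ)) * ((((volume : Measure ℍ).prod (volume : Measure ℍ)).prod (volume : Measure ℍ)) domSet4).toReal +
      Real.log (δ / a) / 64 * (8 * r₀ * ((((volume : Measure ℍ).prod (volume : Measure ℍ)).prod (volume : Measure ℍ)) domSet4).toReal +
        (1 / 2 + 6 * δ) * B.toReal) := by
  have h := Irad_le ht ha haδ hδ1 hr₀ hB
  set D := (((volume : Measure ℍ).prod (volume : Measure ℍ)).prod (volume : Measure ℍ)) domSet4 with hD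
  have hDt : D ≠ ⊤ := volume_domSet4_lt_top.ne
  have hCt : decayConst ≠ ⊤ := decayConst_lt_top.ne
  have hδ : 0 < δ := ha.trans_le haδ
  have hL : 0 ≤ Real.log (δ / a) / 64 := div_nonneg (Real.log_nonneg (by rw [le_div_iff₀ ha]; linarith)) (by norm_num)
  have h2 := ENNReal.toReal_mono (by finiteness) h
  rw [ENNReal.toReal_add (by finiteness) (by finiteness), ENNReal.toReal_add (by finiteness) (by finiteness)] at h2
  simp only [ENNReal.toReal_mul] at h2
  rw [ENNReal.toReal_add (by finiteness) (by finiteness)] at h2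
  simp only [ENNReal.toReal_mul] at h2
  rw [ENNReal.toReal_ofReal hL, ENNReal.toReal_ofReal (by norm_num : (0:ℝ) ≤ 2), ENNReal.toReal_ofReal (by positivity : (0:ℝ) ≤ a * (Real.sqrt 2 / (64 * Real.sqrt t))),
    ENNReal.toReal_ofReal (by positivity : (0:ℝ) ≤ 1 / (64 * δ)), ENNReal.toReal_ofReal (by positivity : (0:ℝ) ≤ 8 * r₀),
    ENNReal.toReal_ofReal (by positivity : (0:ℝ) ≤ 1 / 2 + 6 * δ)] at h2
  linarith [h2]

/-- Real form of ✓`le_Irad` (finite `B⁻`, `t > 0`). [folklore] -/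
theorem le_Irad_toReal {t a δ r₀ : ℝ} (ht : 0 < t) (ha : 0 < a) (haδ : a ≤ δ) (hr₀ : 0 < r₀) (hrδ : r₀ ^ 2 + δ ^ 2 < 1) {B : ℝ≥0∞} (hBt : B ≠ ⊤)
    (hB : ∀ r ρ : ℝ, r₀ < |r| → r ^ 2 + δ ^ 2 < 1 → ρ ∈ Ioc a δ → B ≤ Vrad t r ρ) :
    Real.log (δ / a) / 64 * ((((1 - δ ^ 2) ^ 2 - r₀ ^ 4) / 2) * B.toReal) ≤ (Irad t).toReal := by
  have h := le_Irad (t := t) ha haδ hr₀ hrδ hB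
  have hL : 0 ≤ Real.log (δ / a) / 64 := div_nonneg (Real.log_nonneg (by rw [le_div_iff₀ ha]; linarith)) (by norm_num)
  have hP : 0 ≤ ((1 - δ ^ 2) ^ 2 - r₀ ^ 4) / 2 := by
    have hδ2 : r₀ ^ 2 < 1 - δ ^ 2 := by linarith
    have : r₀ ^ 4 < (1 - δ ^ 2) ^ 2 := by
      have := pow_lt_pow_left₀ hδ2 (by positivity) two_ne_zero
      calc r₀ ^ 4 = (r₀ ^ 2) ^ 2 := by ring
        _ < (1 - δ ^ 2) ^ 2 := this
    linarith
  have e : ENNReal.ofReal (Real.log (δ / a) / 64) * (ENNReal.ofReal (((1 - δ ^ 2) ^ 2 - r₀ ^ 4) / 2) * B) =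
      ENNReal.ofReal (Real.log (δ / a) / 64 * ((((1 - δ ^ 2) ^ 2 - r₀ ^ 4) / 2) * B.toReal)) := by
    rw [← ENNReal.ofReal_toReal hBt, ENNReal.toReal_ofReal ENNReal.toReal_nonneg, ← ENNReal.ofReal_mul hP, ← ENNReal.ofReal_mul hL]
  rw [e] at h
  have h2 := ENNReal.toReal_mono (Irad_lt_top ht).ne h
  rwa [ENNReal.toReal_ofReal (mul_nonneg hL (mul_nonneg hP ENNReal.toReal_nonneg))] at h2

/-- ★ **The middle region is in the joint-limit regime**: for `|a₀| > r₀`, `ρ ∈ (A√t, δ]`, `a₀² + ρ² < 1`, with `δ² < θr₀²`, `t ≤ 4A²θ`,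
`A ≥ max(1, 1/θ)`, the three two-scale parameters of `V_t(a₀, ρ)` are `< θ`. [folklore] -/
theorem middle_small {t A θ δ r₀ r ρ : ℝ} (ht : 0 < t) (hθ : 0 < θ) (hA1 : 1 ≤ A) (hAθ : 1 / θ ≤ A) (hr₀ : 0 < r₀) (hδθ : δ ^ 2 < θ * r₀ ^ 2)
    (htθ : t ≤ 4 * A ^ 2 * θ) (hr : r₀ < |r|) (hρa : A * Real.sqrt t < ρ) (hρδ : ρ ≤ δ) (hin : r ^ 2 + ρ ^ 2 < 1) :
    ρ ^ 2 / (r ^ 2 + ρ ^ 2) < θ ∧ t ^ 2 * (r ^ 2 + ρ ^ 2) / (4 * ρ ^ 2) < θ ∧ t ^ 2 * (r ^ 2 + ρ ^ 2) ^ 2 / (4 * ρ ^ 4) < θ := by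
  have hA0 : 0 < A := by linarith
  have hρ : 0 < ρ := lt_of_le_of_lt (by positivity) hρa
  have hs : 0 < r ^ 2 + ρ ^ 2 := by positivity
  have hr2 : r₀ ^ 2 < r ^ 2 := by
    have h := sq_lt_sq' (by linarith [abs_nonneg r]) hr
    rwa [sq_abs] at h
  have hρ2 : ρ ^ 2 ≤ δ ^ 2 := pow_le_pow_left₀ hρ.le hρδ 2
  have hAt : A ^ 2 * t < ρ ^ 2 := by
    have h := pow_lt_pow_left₀ hρa (by positivity) two_ne_zero
    rwa [mul_pow, Real.sq_sqrt ht.le] at h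
  have hθA : 1 ≤ θ * A := by rw [div_le_iff₀ hθ] at hAθ; linarith
  have hA4 : A ≤ A ^ 4 := le_self_pow₀ hA1 (by norm_num)
  have hθA4 : 1 ≤ θ * A ^ 4 := hθA.trans (mul_le_mul_of_nonneg_left hA4 hθ.le)
  have hss : (r ^ 2 + ρ ^ 2) ^ 2 < 1 := pow_lt_one₀ hs.le hin two_ne_zero
  have hAt2 : A ^ 4 * t ^ 2 < ρ ^ 4 := by
    have h := pow_lt_pow_left₀ hAt (by positivity) two_ne_zero
    calc A ^ 4 * t ^ 2 = (A ^ 2 * t) ^ 2 := by ring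
      _ < (ρ ^ 2) ^ 2 := h
      _ = ρ ^ 4 := by ring
  refine ⟨?_, ?_, ?_⟩
  · rw [div_lt_iff₀ hs]
    nlinarith [mul_lt_mul_of_pos_left hr2 hθ, mul_nonneg hθ.le (sq_nonneg ρ)]
  · rw [div_lt_iff₀ (by positivity)]
    nlinarith [mul_lt_mul_of_pos_left hin (pow_pos ht 2), mul_le_mul_of_nonneg_left htθ ht.le, mul_lt_mul_of_pos_left hAt (by positivity : (0:ℝ) < 4 * θ)]
  · rw [div_lt_iff₀ (by positivity)]
    nlinarith [mul_lt_mul_of_pos_left hss (pow_pos ht 2), mul_lt_mul_of_pos_left hAt2 hθ,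
      mul_le_mul_of_nonneg_right hθA4 (sq_nonneg t), pow_pos ht 2]

/-- Positivity of a positive scalar in `ℝ≥0∞`. [folklore] -/
theorem ofReal_ne_zero_of_pos {ε : ℝ} (hε : 0 < ε) : ENNReal.ofReal ε ≠ 0 := (ENNReal.ofReal_pos.2 hε).ne'

/-- Small positive times are eventually below any positive threshold (within `𝓝[>] 0`). [folklore] -/
theorem eventually_pos_lt {t₁ : ℝ} (h : 0 < t₁) : ∀ᶠ t in 𝓝[>] (0:ℝ), 0 < t ∧ t < t₁ := by
  have h1 : ∀ᶠ t in 𝓝[>] (0:ℝ), 0 < t := eventually_mem_nhdsWithin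
  have h2 : ∀ᶠ t in 𝓝[>] (0:ℝ), t < t₁ := eventually_nhdsWithin_of_eventually_nhds (eventually_lt_nhds h)
  exact h1.and h2

/-- `A·√t ≤ δ` once `t ≤ (δ/A)²`. [folklore] -/
theorem mul_sqrt_le {A δ t : ℝ} (hA : 0 < A) (hδ : 0 ≤ δ) (ht : t ≤ (δ / A) ^ 2) : A * Real.sqrt t ≤ δ := by
  have h1 : Real.sqrt t ≤ δ / A := by
    rw [← Real.sqrt_sq (by positivity : 0 ≤ δ / A)]; exact Real.sqrt_le_sqrt ht
  calc A * Real.sqrt t ≤ A * (δ / A) := mul_le_mul_of_nonneg_left h1 hA.le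
    _ = δ := mul_div_cancel₀ _ hA.ne'

/-- `log(δ/(A√t)) = log(δ/A) + log(1/t)/2`. [folklore] -/
theorem log_div_mul_sqrt {A δ t : ℝ} (hA : 0 < A) (hδ : 0 < δ) (ht : 0 < t) :
    Real.log (δ / (A * Real.sqrt t)) = Real.log (δ / A) + Real.log (1 / t) / 2 := by
  have hsqt : 0 < Real.sqrt t := Real.sqrt_pos.2 ht
  rw [Real.log_div hδ.ne' (mul_pos hA hsqt).ne', Real.log_mul hA.ne' hsqt.ne', Real.log_sqrt ht.le, Real.log_div hδ.ne' hA.ne',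
    one_div, Real.log_inv]
  ring

/-! ## §42 The limit `I(t)/log(1/t) → h₀/256` -/

/-- Pure real bookkeeping of the upper half. [folklore] -/
theorem div_lt_of_affine_bound {I ℓ K₀ M L b gap : ℝ} (hℓ : 0 < ℓ) (hM : 0 ≤ M) (hL : L ≤ ℓ / 2) (hI : I ≤ K₀ + L / 64 * M)
    (hU : M / 128 ≤ b - gap / 2) (hK : K₀ < gap / 2 * ℓ) : I / ℓ < b := by
  rw [div_lt_iff₀ hℓ]
  have h1 : L / 64 * M ≤ ℓ / 2 / 64 * M := mul_le_mul_of_nonneg_right (by linarith) hM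
  have h2 : ℓ * (M / 128) ≤ ℓ * (b - gap / 2) := mul_le_mul_of_nonneg_left hU hℓ.le
  have h3 : ℓ / 2 / 64 * M = ℓ * (M / 128) := by ring
  linarith

/-- Pure real bookkeeping of the lower half. [folklore] -/
theorem lt_div_of_affine_bound {I ℓ Lg P b gap : ℝ} (hℓ : 0 < ℓ) (hP : 0 ≤ P) (hI : (Lg + ℓ / 2) / 64 * P ≤ I) (hPb : b + gap / 2 ≤ P / 128)
    (hQ : |Lg| * P / 64 < gap / 2 * ℓ) : b < I / ℓ := by
  rw [lt_div_iff₀ hℓ]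
  have h1 : -|Lg| * P ≤ Lg * P := mul_le_mul_of_nonneg_right (neg_abs_le _) hP
  have h2 : b * ℓ ≤ (P / 128 - gap / 2) * ℓ := mul_le_mul_of_nonneg_right (by linarith) hℓ.le
  have h3 : (Lg + ℓ / 2) / 64 * P = Lg * P / 64 + ℓ * P / 128 := by ring
  have h4 : (P / 128 - gap / 2) * ℓ = ℓ * P / 128 - gap / 2 * ℓ := by ring
  linarith

/-- Parameter choice for the upper half. [folklore] -/
theorem upper_params {h0 Dr gap ε θ : ℝ} (hh0 : 0 ≤ h0) (hDr : 0 ≤ Dr) (hgap : 0 < gap) (hε : 0 < ε) (hθ : 0 < θ) :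
    ∃ r₀ δ : ℝ, 0 < r₀ ∧ 0 < δ ∧ δ ≤ 1 / 2 ∧ δ ^ 2 < θ * r₀ ^ 2 ∧ r₀ * Dr ≤ 2 * gap ∧ δ * (h0 + ε) ≤ gap := by
  set r₀ := min (1/2 : ℝ) (2 * gap / (Dr + 1)) with hr₀def
  have hr₀ : 0 < r₀ := lt_min (by norm_num) (by positivity)
  have hr₀g : r₀ * Dr ≤ 2 * gap := by
    have h1 : r₀ ≤ 2 * gap / (Dr + 1) := min_le_right _ _
    rw [le_div_iff₀ (by positivity)] at h1; nlinarith
  set δ := min (min (1/2 : ℝ) (gap / (h0 + ε + 1))) (r₀ * Real.sqrt θ / 2) with hδdef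
  have hδ : 0 < δ := lt_min (lt_min (by norm_num) (by positivity)) (by positivity)
  have hδh : δ ≤ 1/2 := (min_le_left _ _).trans (min_le_left _ _)
  have hδg : δ * (h0 + ε) ≤ gap := by
    have h1 : δ ≤ gap / (h0 + ε + 1) := (min_le_left _ _).trans (min_le_right _ _)
    rw [le_div_iff₀ (by positivity)] at h1; nlinarith
  have hδθ : δ ^ 2 < θ * r₀ ^ 2 := by
    have h1 : δ ≤ r₀ * Real.sqrt θ / 2 := min_le_right _ _
    have h2 : δ ^ 2 ≤ (r₀ * Real.sqrt θ / 2) ^ 2 := pow_le_pow_left₀ hδ.le h1 2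
    have h3 : (r₀ * Real.sqrt θ / 2) ^ 2 = θ * r₀ ^ 2 / 4 := by rw [div_pow, mul_pow, Real.sq_sqrt hθ.le]; ring
    have h4 : 0 < θ * r₀ ^ 2 := mul_pos hθ (pow_pos hr₀ 2)
    linarith
  exact ⟨r₀, δ, hr₀, hδ, hδh, hδθ, hr₀g, hδg⟩

/-- Parameter choice for the lower half. [folklore] -/
theorem lower_params {h0 gap θ : ℝ} (hh0 : 0 ≤ h0) (hgap : 0 < gap) (hθ : 0 < θ) :
    ∃ r₀ δ : ℝ, 0 < r₀ ∧ r₀ ≤ 1 / 2 ∧ 0 < δ ∧ δ ≤ 1 / 2 ∧ δ ^ 2 < θ * r₀ ^ 2 ∧ r₀ * h0 ≤ 16 * gap ∧ δ * h0 ≤ 8 * gap := by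
  set r₀ := min (1/2 : ℝ) (16 * gap / (h0 + 1)) with hr₀def
  have hr₀ : 0 < r₀ := lt_min (by norm_num) (by positivity)
  have hr₀h : r₀ ≤ 1/2 := min_le_left _ _
  have hr₀g : r₀ * h0 ≤ 16 * gap := by
    have h1 : r₀ ≤ 16 * gap / (h0 + 1) := min_le_right _ _
    rw [le_div_iff₀ (by positivity)] at h1; nlinarith
  set δ := min (min (1/2 : ℝ) (8 * gap / (h0 + 1))) (r₀ * Real.sqrt θ / 2) with hδdef
  have hδ : 0 < δ := lt_min (lt_min (by norm_num) (by positivity)) (by positivity)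
  have hδh : δ ≤ 1/2 := (min_le_left _ _).trans (min_le_left _ _)
  have hδg : δ * h0 ≤ 8 * gap := by
    have h1 : δ ≤ 8 * gap / (h0 + 1) := (min_le_left _ _).trans (min_le_right _ _)
    rw [le_div_iff₀ (by positivity)] at h1; nlinarith
  have hδθ : δ ^ 2 < θ * r₀ ^ 2 := by
    have h1 : δ ≤ r₀ * Real.sqrt θ / 2 := min_le_right _ _
    have h2 : δ ^ 2 ≤ (r₀ * Real.sqrt θ / 2) ^ 2 := pow_le_pow_left₀ hδ.le h1 2
    have h3 : (r₀ * Real.sqrt θ / 2) ^ 2 = θ * r₀ ^ 2 / 4 := by rw [div_pow, mul_pow, Real.sq_sqrt hθ.le]; ring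
    have h4 : 0 < θ * r₀ ^ 2 := mul_pos hθ (pow_pos hr₀ 2)
    linarith
  exact ⟨r₀, δ, hr₀, hr₀h, hδ, hδh, hδθ, hr₀g, hδg⟩

/-- ★ **Upper bound on the middle regime, real form**: with `θ` from `exists_theta` (for `ε`) and admissible `A, δ, r₀, t`,
`I(t) ≤ 2(A√2/64)·C + 2/(64δ)·D + log(δ/(A√t))/64·(8r₀D + (1/2+6δ)(h₀+ε))`. [folklore] -/
theorem Irad_toReal_le_middle {t A θ δ r₀ ε : ℝ} (ht : 0 < t) (hθ : 0 < θ) (hA1 : 1 ≤ A) (hAθ : 1 / θ ≤ A) (hr₀ : 0 < r₀) (hδ : 0 < δ)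
    (hδ1 : δ ≤ 1) (hδθ : δ ^ 2 < θ * r₀ ^ 2) (htθ : t ≤ 4 * A ^ 2 * θ) (htδ : t ≤ (δ / A) ^ 2) (hε : 0 < ε)
    (hθV : ∀ η ζ κ : ℝ, 0 ≤ η → 0 ≤ ζ → 0 ≤ κ → η < θ → ζ < θ → κ < θ →
      (((volume : Measure ℍ).prod (volume : Measure ℍ)).prod (volume : Measure ℍ)) (twoScaleSet4 η ζ κ) ∈
        Icc ((((volume : Measure ℍ).prod (volume : Measure ℍ)).prod (volume : Measure ℍ)) (twoScaleSet4 0 0 0) - ENNReal.ofReal ε)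
          ((((volume : Measure ℍ).prod (volume : Measure ℍ)).prod (volume : Measure ℍ)) (twoScaleSet4 0 0 0) + ENNReal.ofReal ε)) :
    (Irad t).toReal ≤ 2 * (A * (Real.sqrt 2 / 64)) * decayConst.toReal +
      2 * (1 / (64 * δ)) * ((((volume : Measure ℍ).prod (volume : Measure ℍ)).prod (volume : Measure ℍ)) domSet4).toReal +
      Real.log (δ / (A * Real.sqrt t)) / 64 * (8 * r₀ * ((((volume : Measure ℍ).prod (volume : Measure ℍ)).prod (volume : Measure ℍ)) domSet4).toReal +
        (1 / 2 + 6 * δ) * (((((volume : Measure ℍ).prod (volume : Measure ℍ)).prod (volume : Measure ℍ)) (twoScaleSet4 0 0 0)).toReal + ε)) := by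
  set V0 := (((volume : Measure ℍ).prod (volume : Measure ℍ)).prod (volume : Measure ℍ)) (twoScaleSet4 0 0 0) with hV0
  have hV0t : V0 ≠ ⊤ := (volume_twoScaleSet4_lt_top le_rfl le_rfl le_rfl).ne
  have hA0 : 0 < A := by linarith
  have hsqt : 0 < Real.sqrt t := Real.sqrt_pos.2 ht
  have ha : 0 < A * Real.sqrt t := by positivity
  have haδ : A * Real.sqrt t ≤ δ := mul_sqrt_le hA0 hδ.le htδ
  have hBt : V0 + ENNReal.ofReal ε ≠ ⊤ := by finiteness
  have hB : ∀ r ρ : ℝ, r₀ < |r| → ρ ∈ Ioc (A * Real.sqrt t) δ → r ^ 2 + ρ ^ 2 < 1 → Vrad t r ρ ≤ V0 + ENNReal.ofReal ε := by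
    intro r ρ hr hρ hin
    have hρ0 : 0 < ρ := ha.trans hρ.1
    obtain ⟨e1, e2, e3⟩ := middle_small ht hθ hA1 hAθ hr₀ hδθ htθ hr hρ.1 hρ.2 hin
    exact (hθV _ _ _ (by positivity) (by positivity) (by positivity) e1 e2 e3).2
  have hI := Irad_toReal_le ht ha haδ hδ1 hr₀ hBt hB
  have e1 : A * Real.sqrt t * (Real.sqrt 2 / (64 * Real.sqrt t)) = A * (Real.sqrt 2 / 64) := by
    field_simp
  have e2 : (V0 + ENNReal.ofReal ε).toReal = V0.toReal + ε := by rw [ENNReal.toReal_add hV0t ENNReal.ofReal_ne_top, ENNReal.toReal_ofReal hε.le]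
  rw [e1, e2] at hI
  exact hI

/-- ★ **Lower bound on the middle regime, real form**: `(log(δ/(A√t)))/64·(((1−δ²)²−r₀⁴)/2)·(h₀−ε) ≤ I(t)`. [folklore] -/
theorem le_Irad_toReal_middle {t A θ δ r₀ ε : ℝ} (ht : 0 < t) (hθ : 0 < θ) (hA1 : 1 ≤ A) (hAθ : 1 / θ ≤ A) (hr₀ : 0 < r₀) (hδ : 0 < δ)
    (hrδ : r₀ ^ 2 + δ ^ 2 < 1) (hδθ : δ ^ 2 < θ * r₀ ^ 2) (htθ : t ≤ 4 * A ^ 2 * θ) (htδ : t ≤ (δ / A) ^ 2) (hε : 0 < ε)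
    (hεh : ε ≤ ((((volume : Measure ℍ).prod (volume : Measure ℍ)).prod (volume : Measure ℍ)) (twoScaleSet4 0 0 0)).toReal)
    (hθV : ∀ η ζ κ : ℝ, 0 ≤ η → 0 ≤ ζ → 0 ≤ κ → η < θ → ζ < θ → κ < θ →
      (((volume : Measure ℍ).prod (volume : Measure ℍ)).prod (volume : Measure ℍ)) (twoScaleSet4 η ζ κ) ∈
        Icc ((((volume : Measure ℍ).prod (volume : Measure ℍ)).prod (volume : Measure ℍ)) (twoScaleSet4 0 0 0) - ENNReal.ofReal ε)
          ((((volume : Measure ℍ).prod (volume : Measure ℍ)).prod (volume : Measure ℍ)) (twoScaleSet4 0 0 0) + ENNReal.ofReal ε)) :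
    Real.log (δ / (A * Real.sqrt t)) / 64 * ((((1 - δ ^ 2) ^ 2 - r₀ ^ 4) / 2) *
      (((((volume : Measure ℍ).prod (volume : Measure ℍ)).prod (volume : Measure ℍ)) (twoScaleSet4 0 0 0)).toReal - ε)) ≤ (Irad t).toReal := by
  set V0 := (((volume : Measure ℍ).prod (volume : Measure ℍ)).prod (volume : Measure ℍ)) (twoScaleSet4 0 0 0) with hV0
  have hV0t : V0 ≠ ⊤ := (volume_twoScaleSet4_lt_top le_rfl le_rfl le_rfl).ne
  have hA0 : 0 < A := by linarith
  have hsqt : 0 < Real.sqrt t := Real.sqrt_pos.2 ht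
  have ha : 0 < A * Real.sqrt t := by positivity
  have haδ : A * Real.sqrt t ≤ δ := mul_sqrt_le hA0 hδ.le htδ
  have hBt : V0 - ENNReal.ofReal ε ≠ ⊤ := by finiteness
  have hB : ∀ r ρ : ℝ, r₀ < |r| → r ^ 2 + δ ^ 2 < 1 → ρ ∈ Ioc (A * Real.sqrt t) δ → V0 - ENNReal.ofReal ε ≤ Vrad t r ρ := by
    intro r ρ hr hrδ' hρ
    have hρ0 : 0 < ρ := ha.trans hρ.1
    have hρ2 : ρ ^ 2 ≤ δ ^ 2 := pow_le_pow_left₀ hρ0.le hρ.2 2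
    have hin : r ^ 2 + ρ ^ 2 < 1 := by linarith
    obtain ⟨e1, e2, e3⟩ := middle_small ht hθ hA1 hAθ hr₀ hδθ htθ hr hρ.1 hρ.2 hin
    exact (hθV _ _ _ (by positivity) (by positivity) (by positivity) e1 e2 e3).1
  have hI := le_Irad_toReal ht ha haδ hr₀ hrδ hBt hB
  have e2 : (V0 - ENNReal.ofReal ε).toReal = V0.toReal - ε := by
    rw [ENNReal.toReal_sub_of_le ((ENNReal.ofReal_le_iff_le_toReal hV0t).2 hεh) hV0t, ENNReal.toReal_ofReal hε.le]
  rw [e2] at hI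
  exact hI

end Summit.QuantumFields.YangMills.Theorems.SwapVirialDeficit.ZeroModeGroup

end
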